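import Summits.ResolutionOfSingularities.ResolutionOfSingularities.Theses.RisoStrata

/-!
# Route RisoStrata — Assembly (item stmt-ResolutionOfSingularities-18794)

The assembly item of route `RisoStrata` (rev 1, crux-only deciding theorem) reads

  `Assembly := RtdLocal → RisoCentresResolve → RisoGlobalisation → DescentAlgclosedToPerfect →
    DescentPerfectToAll → ResolutionOfSingularities`,

which is literally the type of the route's deciding theorem `closes`. The chain: unfold
`ResolutionOfSingularities_iff` and fix a prime `p`; `DescentPerfectToAll` reduces
`ResolutionInChar p` to perfect ground fields, `DescentAlgclosedToPerfect` to algebraically closed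
ones; over an algebraically closed `k` a reduced separated finite-type `X/k` is resolved by the
proved tree theorem `Literature.AlgebraicGeometry.Resolution.ComponentGluing.hasResolution_of_forall_closeds`
(resolve the finitely many integral closed subschemes `V(𝔭) ↪ X` and glue) once every integral
closed subscheme is resolved, and that is `RisoGlobalisation` fed with `RtdLocal` and
`RisoCentresResolve` at `p`, applied to the composite `V ↪ X → Spec k` (separated, locally of finite
type and quasi-compact by instance composition). All the mathematics of the route lives in the five
hypotheses (items stmt-18840, stmt-18546, stmt-18547, stmt-0550, stmt-0549); this file only records
that the route closes. We give the chain explicitly (rather than `exact closes`) so that the file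
does not depend on the gate-regenerated deciding theorem keeping its name.
-/

-- single-problem summit: the doubled namespace component `ResolutionOfSingularities` is forced
set_option linter.dupNamespace false

namespace Summit.ResolutionOfSingularities.ResolutionOfSingularities.Theorems

open Summit.ResolutionOfSingularities.ResolutionOfSingularities.Theses.RisoStrata

/-- **Assembly of route RisoStrata** (item stmt-ResolutionOfSingularities-18794):
Zariski-locality of the riso-triviality dimension (`RtdLocal`), the riso-centre schedule along
valuations (`RisoCentresResolve`), its globalisation to integral separated finite-type schemes
over algebraically closed fields of characteristic `p` (`RisoGlobalisation`), descent from
algebraically closed to perfect fields (`DescentAlgclosedToPerfect`) and from perfect to all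
fields (`DescentPerfectToAll`) together give `ResolutionOfSingularities`; the reduced ⇒ integral
step is the proved tree theorem `ComponentGluing.hasResolution_of_forall_closeds`.
Proof: modus ponens along the chain at each prime `p`. [folklore] -/
theorem risoStrata_assembly_proof :
    Summit.ResolutionOfSingularities.ResolutionOfSingularities.Theses.RisoStrata.Assembly := by
  unfold Assembly
  intro hLoc hRes hGlob hAlg hPerf
  rw [_root_.ResolutionOfSingularities_iff]
  intro p hp
  refine hPerf p hp (hAlg p hp fun k _ _ _ X f _ _ _ _ => ?_)
  exact Literature.AlgebraicGeometry.Resolution.ComponentGluing.hasResolution_of_forall_closeds X f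
    fun Z hZ => hGlob p hp (hLoc p hp) (hRes p hp) k _
      (CategoryTheory.CategoryStruct.comp
        (AlgebraicGeometry.Scheme.IdealSheafData.vanishingIdeal Z).subschemeι f)
      inferInstance inferInstance inferInstance hZ

end Summit.ResolutionOfSingularities.ResolutionOfSingularities.Theorems
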